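import Summits.Ventures.YMGap.RobustBall.BoundaryDecayBox
import Summits.Ventures.YMGap.RobustBall.SpecificationConcentrationGibbs
import HarnessLib

/-!
# Venture YMGap, track ROBUST-BALL — GAUSSIAN CONCENTRATION, step 2: the tier-1 `ℤ^d` carrier inside ANY robust
# single-link Dobrushin door (single-link influences, finite families, any boundary field, every DLR state)

HONEST FRAMING. WHAT THIS IS: a venture file (cell `pub-ymgap`, track Y2 ROBUST-BALL, seat ds-3, theorems only), the
door-level carrier of the concentration currency C-CONC. Let rb-p1's perturbed specification
`perturbedYM (fundamentalRep (Fin N)) (N β) W supp` (`SU(N)`, every `d`) carry an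
`IsKRContraction … suFrobDist (perturbedNbr supp) C` with row sums `≤ ρ < 1` and let the member have `ℓ^∞`-range `R`
(`R₀ := max(1, R)`) — exactly the hypotheses of `BoundaryDecay.lean` / `MassGapOfDoor.lean`. For a Lipschitz cylinder
`F` (constant `K`, links `Δ`) put `c_F(y) := 2√N · K · Σ_{z ∈ Δ} ρ^{⌊‖z − y‖_∞ / R₀⌋₊}` (base points). Then:

* SINGLE-LINK BOUNDARY INFLUENCE (`abs_kernel_sub_kernel_le_of_isKRContraction`): for EVERY finite volume `Λ`, every
  link `y ∉ Λ` and every two boundary fields `ω = η` off `y`: `|∫ F dγ^W_Λ(·|ω) − ∫ F dγ^W_Λ(·|η)| ≤ c_F(y)` — the tree's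
  single-exterior-site Dobrushin comparison (`DobrushinMetric.abs_kernel_sub_le_of_superSolution`, Dobrushin 1970
  Thm. 3 / Föllmer (2.10)) with the geometric super-solution `z ↦ ρ^{⌊‖z − y‖/R₀⌋₊}`; additive over finite families
  `Σ_{i∈s} F_i` (`abs_kernel_sub_kernel_sum_le_…`; translates of a Lipschitz cylinder: `isLipschitzCylinder_comp_configShift`);
* FINITE VOLUME, ANY BOUNDARY FIELD (`kernel_sum_ge_le_of_isKRContraction`): for every finite family, every `Λ`, `η`,
  `r ≥ 0` and `V ≥ Σ_{y ∈ Λ} (Σ_i c_{F_i}(y))²`: `γ^W_Λ({ΣF − ∫ ΣF dγ^W_Λ(·|η) ≥ r} | η) ≤ exp(−2 r² / V)` (McDiarmid);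
* EVERY DLR STATE about the conditional mean (`dlr_sum_ge_kernel_integral_le_of_isKRContraction`, no uniqueness);
* INFINITE VOLUME (`dlr_sum_abs_sub_integral_ge_le_of_isKRContraction`): if `Σ_{y ∈ boxLinks d n} (Σ_i c_{F_i}(y))² ≤ V`
  for all `n`, then `μ{|ΣF − ∫ ΣF dμ| ≥ r} ≤ 2 exp(−2 r² / V)` for every DLR state `μ` and every `r ≥ 0` (centring moved
  from the conditional mean to the mean by g12's boundary rate along boxes, `BoundaryDecayBox.lean`, uniform in `η`).
For spread-out families (translates) the proxy grows like the NUMBER of terms while the range of the sum grows likewise —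
Gaussian concentration AT THE VOLUME SCALE (explicit proxies and cells: `ConcentrationLatticeSums.lean`, `ConcentrationBall.lean`).

WHAT THIS IS NOT: the variance proxy `V` is a parameter here; a Gaussian UPPER bound inside the single-link doors, not
an LDP or a CLT; strong-coupling LATTICE statements, nothing about the continuum limit or the Clay Millennium problem.

References: C. Külske, Comm. Math. Phys. 239 (2003) 29–51, Thm. 1 / Cor. 1; C. McDiarmid, Surveys in Combinatorics
1989, Lemma (1.2) and §3; R. L. Dobrushin, Theory Probab. Appl. 15 (1970), Thm. 3; H. Föllmer, LNM 1362 (1988), Ch. I (2.8)/(2.10);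
the tree's `DobrushinComparisonBoundary.lean`, `SpecificationConcentration*.lean`, `BoundaryDecayBox.lean`.
-/

noncomputable section

open MeasureTheory Filter Function ProbabilityTheory Real
open scoped NNReal Topology
open Literature.Probability.LatticeModels
open Literature.Probability.LatticeModels.DobrushinMetric
open Literature.MathematicalPhysics.QuantumLattice
open Literature.MathematicalPhysics.QuantumFieldTheory hiding ZdEdge

namespace Summit.Ventures.YMGap.RobustBall

variable {d N : ℕ} {ι : Type*}

/-! ### The geometric super-solution around one link -/

/-- If `‖x − z‖ ≤ R₀` then `⌊‖x − y‖/R₀⌋₊ ≤ ⌊‖z − y‖/R₀⌋₊ + 1` (base points). [folklore] -/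
theorem natFloor_div_le_of_norm_sub_le {R₀ : ℝ} (hR₀ : 0 < R₀) {x z : ZdEdge d} (y : ZdEdge d)
    (h : ‖x.1 - z.1‖ ≤ R₀) : ⌊‖x.1 - y.1‖ / R₀⌋₊ ≤ ⌊‖z.1 - y.1‖ / R₀⌋₊ + 1 := by
  have h1 : ‖x.1 - y.1‖ ≤ ‖z.1 - y.1‖ + R₀ := by
    have := norm_sub_le_norm_sub_add_norm_sub x.1 z.1 y.1
    linarith
  have h2 : ‖x.1 - y.1‖ / R₀ ≤ ‖z.1 - y.1‖ / R₀ + 1 := by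
    rw [div_add_one hR₀.ne', div_le_div_iff_of_pos_right hR₀]
    linarith
  exact (Nat.floor_mono h2).trans (natFloor_add_one_le _)

/-- **The geometric profile `z ↦ ρ^{⌊‖z − y‖/R₀⌋₊}` is a super-solution** for nonnegative coefficients with row sums
`≤ ρ ≤ 1` and range `≤ R₀`: `Σ_{z ∈ nbr x} C x z · ρ^{⌊‖z − y‖/R₀⌋₊} ≤ ρ^{⌊‖x − y‖/R₀⌋₊}`. [folklore] -/
theorem sum_mul_pow_natFloor_le {ρ R₀ : ℝ} (hρ0 : 0 ≤ ρ) (hρ1 : ρ ≤ 1) (hR₀ : 0 < R₀)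
    {nbr : ZdEdge d → Finset (ZdEdge d)} {C : ZdEdge d → ZdEdge d → ℝ} (hC0 : ∀ x z, 0 ≤ C x z)
    (hrow : ∀ x, ∑ z ∈ nbr x, C x z ≤ ρ) (hnbr : ∀ x, ∀ z ∈ nbr x, ‖x.1 - z.1‖ ≤ R₀) (y x : ZdEdge d) :
    ∑ z ∈ nbr x, C x z * ρ ^ ⌊‖z.1 - y.1‖ / R₀⌋₊ ≤ ρ ^ ⌊‖x.1 - y.1‖ / R₀⌋₊ := by
  set n := ⌊‖x.1 - y.1‖ / R₀⌋₊ with hn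
  have hz : ∀ z ∈ nbr x, ρ ^ ⌊‖z.1 - y.1‖ / R₀⌋₊ ≤ ρ ^ (n - 1) := fun z hz =>
    pow_le_pow_of_le_one hρ0 hρ1 (by
      have := natFloor_div_le_of_norm_sub_le hR₀ y (hnbr x z hz)
      omega)
  calc ∑ z ∈ nbr x, C x z * ρ ^ ⌊‖z.1 - y.1‖ / R₀⌋₊
      ≤ ∑ z ∈ nbr x, C x z * ρ ^ (n - 1) :=
        Finset.sum_le_sum fun z hz' => mul_le_mul_of_nonneg_left (hz z hz') (hC0 x z)
    _ = (∑ z ∈ nbr x, C x z) * ρ ^ (n - 1) := (Finset.sum_mul _ _ _).symm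
    _ ≤ ρ * ρ ^ (n - 1) := mul_le_mul_of_nonneg_right (hrow x) (pow_nonneg hρ0 _)
    _ ≤ ρ ^ n := by
        rcases Nat.eq_zero_or_pos n with h0 | hpos
        · rw [h0, Nat.zero_sub, pow_zero, mul_one]
          exact hρ1
        · rw [← pow_succ', Nat.sub_add_cancel hpos]

/-! ### The single-link boundary influence of a member inside a KR door -/

/-- **SINGLE-LINK BOUNDARY INFLUENCE from ANY robust single-link door, profile form.** Let
`IsKRContraction (perturbedYM (fundamentalRep (Fin N)) (N β) W supp) suFrobDist (perturbedNbr supp) C` have row sums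
`≤ ρ < 1` and let the member have `ℓ^∞`-range `R`. Then for EVERY finite link volume `Λ`, every link `y ∉ Λ`, every two
boundary fields `ω, η` agreeing off `y`, and every Lipschitz cylinder `F` (constant `K`, links `Δ`):
`|∫ F dγ^W_Λ(·|ω) − ∫ F dγ^W_Λ(·|η)| ≤ 2√N · K · Σ_{z ∈ Δ} ρ^{⌊‖z − y‖_∞ / max(1,R)⌋₊}` — the tree's
`abs_kernel_sub_le_of_superSolution` (Dobrushin 1970, Thm. 3; Föllmer 1988, (2.8)/(2.10)) with the geometric
super-solution `sum_mul_pow_natFloor_le`. [folklore] -/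
theorem abs_kernel_sub_kernel_le_of_isKRContraction {β ρ R : ℝ}
    {W : Potential (ZdEdge d) (Matrix.specialUnitaryGroup (Fin N) ℂ)} (hW : W.IsAdapted)
    (hWb : ∀ X, ∃ C, ∀ U, |W X U| ≤ C)
    {supp : Finset (ZdEdge d) → Finset (Finset (ZdEdge d))} (hsupp : W.IsSupportedBy supp)
    {C : ZdEdge d → ZdEdge d → ℝ}
    (hKR : IsKRContraction (perturbedYM (d := d) (fundamentalRep (Fin N)) (N * β) W supp) suFrobDist
      (perturbedNbr supp) C)
    (hrow : ∀ x, ∑ y ∈ perturbedNbr supp x, C x y ≤ ρ) (hρ : ρ < 1)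
    (hR : ∀ e, ∀ X ∈ supp {e}, e ∈ X → ∀ y ∈ X, ‖e.1 - y.1‖ ≤ R)
    (Λ : Finset (ZdEdge d)) {y : ZdEdge d} (hy : y ∉ Λ)
    {ω η : LGConfig d (Matrix.specialUnitaryGroup (Fin N) ℂ)} (hωη : ∀ z, z ≠ y → ω z = η z)
    {F : LGConfig d (Matrix.specialUnitaryGroup (Fin N) ℂ) → ℝ} {Δ : Finset (ZdEdge d)} {K : ℝ≥0}
    (hF : IsLipschitzCylinder (fundamentalRep (Fin N)) F Δ K) :
    |(∫ U, F U ∂(perturbedYM (d := d) (fundamentalRep (Fin N)) (N * β) W supp Λ ω)) -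
        ∫ U, F U ∂(perturbedYM (d := d) (fundamentalRep (Fin N)) (N * β) W supp Λ η)| ≤
      2 * Real.sqrt N * K * ∑ z ∈ Δ, ρ ^ ⌊‖z.1 - y.1‖ / max 1 R⌋₊ := by
  classical
  haveI : SecondCountableTopology (Matrix (Fin N) (Fin N) ℂ) :=
    inferInstanceAs (SecondCountableTopology (Fin N → Fin N → ℂ))
  haveI : SecondCountableTopology (Matrix.specialUnitaryGroup (Fin N) ℂ) :=
    Topology.IsEmbedding.subtypeVal.secondCountableTopology
  have hγ : IsSpecification (perturbedYM (d := d) (fundamentalRep (Fin N)) (N * β) W supp) :=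
    isSpecification_perturbedYM _ (continuous_fundamentalRep (Fin N)) _ hW hWb hsupp
  have hρ0 : 0 ≤ ρ := (Finset.sum_nonneg fun z _ => hKR.nonneg y z).trans (hrow y)
  have hR₀0 : 0 < max 1 R := zero_lt_one.trans_le (le_max_left _ _)
  have hRsqrt : (0 : ℝ) ≤ 2 * Real.sqrt N := by positivity
  have hK : (0 : ℝ) ≤ K := K.2
  have hdy : (1 : ℝ) ≤ ρ ^ ⌊‖y.1 - y.1‖ / max 1 R⌋₊ := by
    rw [sub_self, norm_zero, zero_div, Nat.floor_zero, pow_zero]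
  have key := abs_kernel_sub_le_of_superSolution hγ hKR (fun _ _ => suFrobDist_nonneg _ _) suFrobDist_le hRsqrt
    Λ hy hωη (d := fun z => ρ ^ ⌊‖z.1 - y.1‖ / max 1 R⌋₊) (fun z => pow_nonneg hρ0 _) hdy
    (fun x _ => sum_mul_pow_natFloor_le hρ0 hρ.le hR₀0 hKR.nonneg hrow
      (fun x z hz => norm_sub_le_of_mem_perturbedNbr hR x hz) y x)
    hρ0 hρ
    (fun x _ => (Finset.sum_le_sum fun z _ => by
      split_ifs
      · exact le_rfl
      · exact hKR.nonneg x z).trans (hrow x))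
    hF.measurable hF.dependsOn hF.abs_le
    (hF.isLipBound zero_le_one (fun a b => by rw [one_mul]; exact dist_suEntries_le_suFrobDist a b))
  refine key.trans ?_
  have hsum : ∑ z ∈ Δ, ρ ^ ⌊‖z.1 - y.1‖ / max 1 R⌋₊ * (if z ∈ Δ then 1 * (K : ℝ) else 0) =
      K * ∑ z ∈ Δ, ρ ^ ⌊‖z.1 - y.1‖ / max 1 R⌋₊ := by
    rw [Finset.mul_sum]
    exact Finset.sum_congr rfl fun z hz => by rw [if_pos hz]; ring
  rw [hsum]
  have hS0 : 0 ≤ (K : ℝ) * ∑ z ∈ Δ, ρ ^ ⌊‖z.1 - y.1‖ / max 1 R⌋₊ :=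
    mul_nonneg hK (Finset.sum_nonneg fun z _ => pow_nonneg hρ0 _)
  calc suFrobDist (ω y) (η y) * ((K : ℝ) * ∑ z ∈ Δ, ρ ^ ⌊‖z.1 - y.1‖ / max 1 R⌋₊)
      ≤ 2 * Real.sqrt N * ((K : ℝ) * ∑ z ∈ Δ, ρ ^ ⌊‖z.1 - y.1‖ / max 1 R⌋₊) :=
        mul_le_mul_of_nonneg_right (suFrobDist_le _ _) hS0
    _ = 2 * Real.sqrt N * K * ∑ z ∈ Δ, ρ ^ ⌊‖z.1 - y.1‖ / max 1 R⌋₊ := by ring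

/-! ### Translates and finite sums of Lipschitz cylinders -/


/-- **A translate of a Lipschitz cylinder is a Lipschitz cylinder** with the same constant, on the translated links:
`F ∘ θ_v` is supported on `{(x − v, i) : (x, i) ∈ Δ}` (cf. `IsCylinder.comp_configShift`). [folklore] -/
theorem isLipschitzCylinder_comp_configShift {G : Type*} [Group G] [MeasurableSpace G]
    {ρ : G →* Matrix (Fin N) (Fin N) ℂ} {F : LGConfig d G → ℝ} {Δ : Finset (ZdEdge d)} {K : ℝ≥0}
    (hF : IsLipschitzCylinder ρ F Δ K) (v : Site d) :
    IsLipschitzCylinder ρ (F ∘ configShift v) (Δ.image fun e => (e.1 - v, e.2)) K := by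
  classical
  obtain ⟨f, hf, hFf⟩ := hF
  -- reindexing from the translated support back to `Δ`
  let re : (↥(Δ.image fun e : ZdEdge d => (e.1 - v, e.2)) → Fin N → Fin N → ℂ) → (↥Δ → Fin N → Fin N → ℂ) :=
    fun g e => g ⟨(e.1.1 - v, e.1.2), Finset.mem_image.2 ⟨e.1, e.2, rfl⟩⟩
  have hre : LipschitzWith 1 re := by
    refine LipschitzWith.of_dist_le_mul fun g g' => ?_
    rw [NNReal.coe_one, one_mul]
    refine (dist_pi_le_iff dist_nonneg).2 fun e => ?_
    exact dist_le_pi_dist g g' _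
  refine ⟨f ∘ re, by simpa using hf.comp hre, fun U => ?_⟩
  simp only [Function.comp_apply, hFf]
  congr 1

/-- A finite sum of Lipschitz cylinders is measurable and bounded by `Σ_i (|F_i 1| + 2 K_i)`. [folklore] -/
theorem measurable_sum_of_isLipschitzCylinder (s : Finset ι)
    {F : ι → LGConfig d (Matrix.specialUnitaryGroup (Fin N) ℂ) → ℝ} {Δ : ι → Finset (ZdEdge d)} {K : ι → ℝ≥0}
    (hF : ∀ i ∈ s, IsLipschitzCylinder (fundamentalRep (Fin N)) (F i) (Δ i) (K i)) :
    Measurable (fun U => ∑ i ∈ s, F i U) ∧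
      ∀ U, |∑ i ∈ s, F i U| ≤ ∑ i ∈ s, (|F i 1| + 2 * K i) :=
  ⟨Finset.measurable_sum s fun i hi => (hF i hi).measurable,
    fun U => (Finset.abs_sum_le_sum_abs _ _).trans (Finset.sum_le_sum fun i hi => (hF i hi).abs_le U)⟩

/-- **Single-link boundary influence of a finite sum of Lipschitz cylinders**: under the hypotheses of
`abs_kernel_sub_kernel_le_of_isKRContraction`, for `y ∉ Λ` and `ω = η` off `y`,
`|∫ Σ_i F_i dγ^W_Λ(·|ω) − ∫ Σ_i F_i dγ^W_Λ(·|η)| ≤ Σ_i 2√N · K_i · Σ_{z ∈ Δ_i} ρ^{⌊‖z − y‖/max(1,R)⌋₊}`. [folklore] -/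
theorem abs_kernel_sub_kernel_sum_le_of_isKRContraction {β ρ R : ℝ}
    {W : Potential (ZdEdge d) (Matrix.specialUnitaryGroup (Fin N) ℂ)} (hW : W.IsAdapted)
    (hWb : ∀ X, ∃ C, ∀ U, |W X U| ≤ C)
    {supp : Finset (ZdEdge d) → Finset (Finset (ZdEdge d))} (hsupp : W.IsSupportedBy supp)
    {C : ZdEdge d → ZdEdge d → ℝ}
    (hKR : IsKRContraction (perturbedYM (d := d) (fundamentalRep (Fin N)) (N * β) W supp) suFrobDist
      (perturbedNbr supp) C)
    (hrow : ∀ x, ∑ y ∈ perturbedNbr supp x, C x y ≤ ρ) (hρ : ρ < 1)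
    (hR : ∀ e, ∀ X ∈ supp {e}, e ∈ X → ∀ y ∈ X, ‖e.1 - y.1‖ ≤ R)
    (Λ : Finset (ZdEdge d)) {y : ZdEdge d} (hy : y ∉ Λ)
    {ω η : LGConfig d (Matrix.specialUnitaryGroup (Fin N) ℂ)} (hωη : ∀ z, z ≠ y → ω z = η z)
    (s : Finset ι) {F : ι → LGConfig d (Matrix.specialUnitaryGroup (Fin N) ℂ) → ℝ} {Δ : ι → Finset (ZdEdge d)}
    {K : ι → ℝ≥0} (hF : ∀ i ∈ s, IsLipschitzCylinder (fundamentalRep (Fin N)) (F i) (Δ i) (K i)) :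
    |(∫ U, ∑ i ∈ s, F i U ∂(perturbedYM (d := d) (fundamentalRep (Fin N)) (N * β) W supp Λ ω)) -
        ∫ U, ∑ i ∈ s, F i U ∂(perturbedYM (d := d) (fundamentalRep (Fin N)) (N * β) W supp Λ η)| ≤
      ∑ i ∈ s, 2 * Real.sqrt N * K i * ∑ z ∈ Δ i, ρ ^ ⌊‖z.1 - y.1‖ / max 1 R⌋₊ := by
  haveI : SecondCountableTopology (Matrix (Fin N) (Fin N) ℂ) :=
    inferInstanceAs (SecondCountableTopology (Fin N → Fin N → ℂ))
  haveI : SecondCountableTopology (Matrix.specialUnitaryGroup (Fin N) ℂ) :=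
    Topology.IsEmbedding.subtypeVal.secondCountableTopology
  have hγ : IsSpecification (perturbedYM (d := d) (fundamentalRep (Fin N)) (N * β) W supp) :=
    isSpecification_perturbedYM _ (continuous_fundamentalRep (Fin N)) _ hW hWb hsupp
  haveI := hγ.isProbability Λ ω
  haveI := hγ.isProbability Λ η
  have hint : ∀ (ξ : LGConfig d (Matrix.specialUnitaryGroup (Fin N) ℂ)), ∀ i ∈ s,
      Integrable (F i) (perturbedYM (d := d) (fundamentalRep (Fin N)) (N * β) W supp Λ ξ) := fun ξ i hi => by
    haveI := hγ.isProbability Λ ξ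
    exact integrable_of_abs_le' (hF i hi).measurable (hF i hi).abs_le
  rw [integral_finsetSum s (hint ω), integral_finsetSum s (hint η), ← Finset.sum_sub_distrib]
  refine (Finset.abs_sum_le_sum_abs _ _).trans (Finset.sum_le_sum fun i hi => ?_)
  exact abs_kernel_sub_kernel_le_of_isKRContraction hW hWb hsupp hKR hrow hρ hR Λ hy hωη (hF i hi)

/-- The boundary rate along boxes tends to zero: `2√N · K · #Δ · max(ρ,½)^{⌊(n − m)/max(1,R)⌋₊} → 0`. [folklore] -/
theorem tendsto_boundaryRate_box {ρ R : ℝ} (hρ : ρ < 1) (A : ℝ) (m : ℕ) :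
    Tendsto (fun n : ℕ => A * (max ρ (1 / 2)) ^ ⌊((n : ℝ) - m) / max 1 R⌋₊) atTop (𝓝 0) := by
  have hc'0 : 0 ≤ max ρ (1 / 2) := le_max_of_le_right (by norm_num)
  have hc'1 : max ρ (1 / 2) < 1 := max_lt hρ (by norm_num)
  have hR₀0 : 0 < max 1 R := zero_lt_one.trans_le (le_max_left _ _)
  have hfloor : Tendsto (fun n : ℕ => ⌊((n : ℝ) - m) / max 1 R⌋₊) atTop atTop := by
    refine tendsto_nat_floor_atTop.comp ?_
    refine Tendsto.atTop_div_const hR₀0 ?_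
    exact tendsto_atTop_add_const_right _ _ tendsto_natCast_atTop_atTop
  have h := (tendsto_pow_atTop_nhds_zero_of_lt_one hc'0 hc'1).comp hfloor
  simpa using h.const_mul A

/-! ### Concentration of finite sums: finite volume, every DLR state, infinite volume -/

/-- **Finite volume, any boundary field, finite sums**: for `V ≥ Σ_{y ∈ Λ} (Σ_i c_{F_i}(y))²` and `r ≥ 0`,
`γ^W_Λ({ΣF − ∫ ΣF dγ^W_Λ(·|η) ≥ r} | η) ≤ exp(−2 r² / V)`. [folklore] -/
theorem kernel_sum_ge_le_of_isKRContraction {β ρ R : ℝ}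
    {W : Potential (ZdEdge d) (Matrix.specialUnitaryGroup (Fin N) ℂ)} (hW : W.IsAdapted)
    (hWb : ∀ X, ∃ C, ∀ U, |W X U| ≤ C)
    {supp : Finset (ZdEdge d) → Finset (Finset (ZdEdge d))} (hsupp : W.IsSupportedBy supp)
    {C : ZdEdge d → ZdEdge d → ℝ}
    (hKR : IsKRContraction (perturbedYM (d := d) (fundamentalRep (Fin N)) (N * β) W supp) suFrobDist
      (perturbedNbr supp) C)
    (hrow : ∀ x, ∑ y ∈ perturbedNbr supp x, C x y ≤ ρ) (hρ : ρ < 1)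
    (hR : ∀ e, ∀ X ∈ supp {e}, e ∈ X → ∀ y ∈ X, ‖e.1 - y.1‖ ≤ R)
    (s : Finset ι) {F : ι → LGConfig d (Matrix.specialUnitaryGroup (Fin N) ℂ) → ℝ} {Δ : ι → Finset (ZdEdge d)}
    {K : ι → ℝ≥0} (hF : ∀ i ∈ s, IsLipschitzCylinder (fundamentalRep (Fin N)) (F i) (Δ i) (K i))
    (Λ : Finset (ZdEdge d)) {Vc : ℝ}
    (hV : ∑ y ∈ Λ, (∑ i ∈ s, 2 * Real.sqrt N * K i * ∑ z ∈ Δ i, ρ ^ ⌊‖z.1 - y.1‖ / max 1 R⌋₊) ^ 2 ≤ Vc)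
    (η : LGConfig d (Matrix.specialUnitaryGroup (Fin N) ℂ)) {r : ℝ} (hr : 0 ≤ r) :
    (perturbedYM (d := d) (fundamentalRep (Fin N)) (N * β) W supp Λ η).real
        {U | r ≤ (∑ i ∈ s, F i U) -
          ∫ U', ∑ i ∈ s, F i U' ∂(perturbedYM (d := d) (fundamentalRep (Fin N)) (N * β) W supp Λ η)} ≤
      exp (-2 * r ^ 2 / Vc) := by
  haveI : SecondCountableTopology (Matrix (Fin N) (Fin N) ℂ) :=
    inferInstanceAs (SecondCountableTopology (Fin N → Fin N → ℂ))
  haveI : SecondCountableTopology (Matrix.specialUnitaryGroup (Fin N) ℂ) :=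
    Topology.IsEmbedding.subtypeVal.secondCountableTopology
  have hγ : IsSpecification (perturbedYM (d := d) (fundamentalRep (Fin N)) (N * β) W supp) :=
    isSpecification_perturbedYM _ (continuous_fundamentalRep (Fin N)) _ hW hWb hsupp
  have hρ0 : ∀ y : ZdEdge d, 0 ≤ ρ := fun y => (Finset.sum_nonneg fun z _ => hKR.nonneg y z).trans (hrow y)
  obtain ⟨hm, hM⟩ := measurable_sum_of_isLipschitzCylinder s hF
  exact SpecConcentration.measureReal_kernel_ge_le_of_le hγ Λ hm hM
    (c := fun y => ∑ i ∈ s, 2 * Real.sqrt N * K i * ∑ z ∈ Δ i, ρ ^ ⌊‖z.1 - y.1‖ / max 1 R⌋₊)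
    (fun y => Finset.sum_nonneg fun i _ => by
      have hK : (0 : ℝ) ≤ K i := (K i).2
      exact mul_nonneg (by positivity) (Finset.sum_nonneg fun z _ => pow_nonneg (hρ0 y) _))
    (fun Λ' _ y _ hy ω η' hωη =>
      abs_kernel_sub_kernel_sum_le_of_isKRContraction hW hWb hsupp hKR hrow hρ hR Λ' hy hωη s hF)
    hV hr η

/-- **Every DLR state, finite sums, about the conditional mean**: `μ{ΣF − ∫ ΣF dγ^W_Λ(·|·) ≥ r} ≤ exp(−2 r² / V)` for
`V ≥ Σ_{y ∈ Λ} (Σ_i c_{F_i}(y))²`. [folklore] -/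
theorem dlr_sum_ge_kernel_integral_le_of_isKRContraction {β ρ R : ℝ}
    {W : Potential (ZdEdge d) (Matrix.specialUnitaryGroup (Fin N) ℂ)} (hW : W.IsAdapted)
    (hWb : ∀ X, ∃ C, ∀ U, |W X U| ≤ C)
    {supp : Finset (ZdEdge d) → Finset (Finset (ZdEdge d))} (hsupp : W.IsSupportedBy supp)
    {C : ZdEdge d → ZdEdge d → ℝ}
    (hKR : IsKRContraction (perturbedYM (d := d) (fundamentalRep (Fin N)) (N * β) W supp) suFrobDist
      (perturbedNbr supp) C)
    (hrow : ∀ x, ∑ y ∈ perturbedNbr supp x, C x y ≤ ρ) (hρ : ρ < 1)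
    (hR : ∀ e, ∀ X ∈ supp {e}, e ∈ X → ∀ y ∈ X, ‖e.1 - y.1‖ ≤ R)
    (s : Finset ι) {F : ι → LGConfig d (Matrix.specialUnitaryGroup (Fin N) ℂ) → ℝ} {Δ : ι → Finset (ZdEdge d)}
    {K : ι → ℝ≥0} (hF : ∀ i ∈ s, IsLipschitzCylinder (fundamentalRep (Fin N)) (F i) (Δ i) (K i))
    (Λ : Finset (ZdEdge d)) {Vc : ℝ}
    (hV : ∑ y ∈ Λ, (∑ i ∈ s, 2 * Real.sqrt N * K i * ∑ z ∈ Δ i, ρ ^ ⌊‖z.1 - y.1‖ / max 1 R⌋₊) ^ 2 ≤ Vc)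
    {μ : Measure (LGConfig d (Matrix.specialUnitaryGroup (Fin N) ℂ))}
    (hμ : μ ∈ perturbedGibbsMeasures (d := d) (fundamentalRep (Fin N)) (N * β) W supp) {r : ℝ} (hr : 0 ≤ r) :
    μ.real {U | r ≤ (∑ i ∈ s, F i U) -
        ∫ U', ∑ i ∈ s, F i U' ∂(perturbedYM (d := d) (fundamentalRep (Fin N)) (N * β) W supp Λ U)} ≤
      exp (-2 * r ^ 2 / Vc) := by
  haveI : SecondCountableTopology (Matrix (Fin N) (Fin N) ℂ) :=
    inferInstanceAs (SecondCountableTopology (Fin N → Fin N → ℂ))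
  haveI : SecondCountableTopology (Matrix.specialUnitaryGroup (Fin N) ℂ) :=
    Topology.IsEmbedding.subtypeVal.secondCountableTopology
  have hγ : IsSpecification (perturbedYM (d := d) (fundamentalRep (Fin N)) (N * β) W supp) :=
    isSpecification_perturbedYM _ (continuous_fundamentalRep (Fin N)) _ hW hWb hsupp
  have hρ0 : ∀ y : ZdEdge d, 0 ≤ ρ := fun y => (Finset.sum_nonneg fun z _ => hKR.nonneg y z).trans (hrow y)
  have hμ' : IsGibbsMeasure (perturbedYM (d := d) (fundamentalRep (Fin N)) (N * β) W supp) μ := hμ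
  obtain ⟨hm, hM⟩ := measurable_sum_of_isLipschitzCylinder s hF
  exact SpecConcentration.measureReal_ge_kernel_integral_le hγ Λ hm hM
    (c := fun y => ∑ i ∈ s, 2 * Real.sqrt N * K i * ∑ z ∈ Δ i, ρ ^ ⌊‖z.1 - y.1‖ / max 1 R⌋₊)
    (fun y => Finset.sum_nonneg fun i _ => by
      have hK : (0 : ℝ) ≤ K i := (K i).2
      exact mul_nonneg (by positivity) (Finset.sum_nonneg fun z _ => pow_nonneg (hρ0 y) _))
    (fun Λ' _ y _ hy ω η' hωη =>
      abs_kernel_sub_kernel_sum_le_of_isKRContraction hW hWb hsupp hKR hrow hρ hR Λ' hy hωη s hF)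
    hV hμ' hr

/-- The boundary rate of a finite sum along boxes: if every `Δ_i ⊆ boxLinks d m` then for every DLR state `μ` and
every boundary field `ω`, `|∫ ΣF dγ^W_{box n}(·|ω) − ∫ ΣF dμ| ≤ (Σ_i 2√N K_i #Δ_i) · max(ρ,½)^{⌊(n − m)/max(1,R)⌋₊}`
(g12's `abs_box_sub_integral_le_of_isKRContraction`, summed). [folklore] -/
theorem abs_box_sum_sub_integral_le_of_isKRContraction {β ρ R : ℝ}
    {W : Potential (ZdEdge d) (Matrix.specialUnitaryGroup (Fin N) ℂ)} (hW : W.IsAdapted)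
    (hWb : ∀ X, ∃ C, ∀ U, |W X U| ≤ C)
    {supp : Finset (ZdEdge d) → Finset (Finset (ZdEdge d))} (hsupp : W.IsSupportedBy supp)
    {C : ZdEdge d → ZdEdge d → ℝ}
    (hKR : IsKRContraction (perturbedYM (d := d) (fundamentalRep (Fin N)) (N * β) W supp) suFrobDist
      (perturbedNbr supp) C)
    (hrow : ∀ x, ∑ y ∈ perturbedNbr supp x, C x y ≤ ρ) (hρ : ρ < 1)
    (hR : ∀ e, ∀ X ∈ supp {e}, e ∈ X → ∀ y ∈ X, ‖e.1 - y.1‖ ≤ R)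
    (s : Finset ι) {F : ι → LGConfig d (Matrix.specialUnitaryGroup (Fin N) ℂ) → ℝ} {Δ : ι → Finset (ZdEdge d)}
    {K : ι → ℝ≥0} (hF : ∀ i ∈ s, IsLipschitzCylinder (fundamentalRep (Fin N)) (F i) (Δ i) (K i))
    {m : ℕ} (hΔ : ∀ i ∈ s, Δ i ⊆ boxLinks d m) (n : ℕ)
    {μ : Measure (LGConfig d (Matrix.specialUnitaryGroup (Fin N) ℂ))}
    (hμ : μ ∈ perturbedGibbsMeasures (d := d) (fundamentalRep (Fin N)) (N * β) W supp)
    (ω : LGConfig d (Matrix.specialUnitaryGroup (Fin N) ℂ)) :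
    |(∫ U, ∑ i ∈ s, F i U ∂(perturbedYM (d := d) (fundamentalRep (Fin N)) (N * β) W supp (boxLinks d n) ω)) -
        ∫ U, ∑ i ∈ s, F i U ∂μ| ≤
      (∑ i ∈ s, 2 * Real.sqrt N * K i * (Δ i).card) * (max ρ (1 / 2)) ^ ⌊((n : ℝ) - m) / max 1 R⌋₊ := by
  haveI : SecondCountableTopology (Matrix (Fin N) (Fin N) ℂ) :=
    inferInstanceAs (SecondCountableTopology (Fin N → Fin N → ℂ))
  haveI : SecondCountableTopology (Matrix.specialUnitaryGroup (Fin N) ℂ) :=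
    Topology.IsEmbedding.subtypeVal.secondCountableTopology
  have hγ : IsSpecification (perturbedYM (d := d) (fundamentalRep (Fin N)) (N * β) W supp) :=
    isSpecification_perturbedYM _ (continuous_fundamentalRep (Fin N)) _ hW hWb hsupp
  have hμ' : IsGibbsMeasure (perturbedYM (d := d) (fundamentalRep (Fin N)) (N * β) W supp) μ := hμ
  haveI := hμ'.isProbabilityMeasure
  haveI := hγ.isProbability (boxLinks d n) ω
  have hint1 : ∀ i ∈ s, Integrable (F i) (perturbedYM (d := d) (fundamentalRep (Fin N)) (N * β) W supp
      (boxLinks d n) ω) := fun i hi => integrable_of_abs_le' (hF i hi).measurable (hF i hi).abs_le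
  have hint2 : ∀ i ∈ s, Integrable (F i) μ := fun i hi =>
    integrable_of_abs_le' (hF i hi).measurable (hF i hi).abs_le
  rw [integral_finsetSum s hint1, integral_finsetSum s hint2, ← Finset.sum_sub_distrib, Finset.sum_mul]
  refine (Finset.abs_sum_le_sum_abs _ _).trans (Finset.sum_le_sum fun i hi => ?_)
  exact abs_box_sub_integral_le_of_isKRContraction hW hWb hsupp hKR hrow hρ hR hμ n ω (hF i hi) (hΔ i hi)

/-- **GAUSSIAN CONCENTRATION OF FINITE SUMS IN INFINITE VOLUME, from ANY robust single-link door**: if the box variance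
proxies of the family are bounded, `Σ_{y ∈ boxLinks d n} (Σ_i c_{F_i}(y))² ≤ V` for every `n`, then for EVERY DLR state
`μ` and every `r ≥ 0`: `μ{|Σ_i F_i − ∫ Σ_i F_i dμ| ≥ r} ≤ 2 exp(−2 r² / V)`. [folklore] -/
theorem dlr_sum_abs_sub_integral_ge_le_of_isKRContraction {β ρ R : ℝ}
    {W : Potential (ZdEdge d) (Matrix.specialUnitaryGroup (Fin N) ℂ)} (hW : W.IsAdapted)
    (hWb : ∀ X, ∃ C, ∀ U, |W X U| ≤ C)
    {supp : Finset (ZdEdge d) → Finset (Finset (ZdEdge d))} (hsupp : W.IsSupportedBy supp)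
    {C : ZdEdge d → ZdEdge d → ℝ}
    (hKR : IsKRContraction (perturbedYM (d := d) (fundamentalRep (Fin N)) (N * β) W supp) suFrobDist
      (perturbedNbr supp) C)
    (hrow : ∀ x, ∑ y ∈ perturbedNbr supp x, C x y ≤ ρ) (hρ : ρ < 1)
    (hR : ∀ e, ∀ X ∈ supp {e}, e ∈ X → ∀ y ∈ X, ‖e.1 - y.1‖ ≤ R)
    (s : Finset ι) {F : ι → LGConfig d (Matrix.specialUnitaryGroup (Fin N) ℂ) → ℝ} {Δ : ι → Finset (ZdEdge d)}
    {K : ι → ℝ≥0} (hF : ∀ i ∈ s, IsLipschitzCylinder (fundamentalRep (Fin N)) (F i) (Δ i) (K i)) {Vc : ℝ}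
    (hV : ∀ n, ∑ y ∈ boxLinks d n,
      (∑ i ∈ s, 2 * Real.sqrt N * K i * ∑ z ∈ Δ i, ρ ^ ⌊‖z.1 - y.1‖ / max 1 R⌋₊) ^ 2 ≤ Vc)
    {μ : Measure (LGConfig d (Matrix.specialUnitaryGroup (Fin N) ℂ))}
    (hμ : μ ∈ perturbedGibbsMeasures (d := d) (fundamentalRep (Fin N)) (N * β) W supp) {r : ℝ} (hr : 0 ≤ r) :
    μ.real {U | r ≤ |(∑ i ∈ s, F i U) - ∫ U', ∑ i ∈ s, F i U' ∂μ|} ≤ 2 * exp (-2 * r ^ 2 / Vc) := by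
  classical
  haveI : SecondCountableTopology (Matrix (Fin N) (Fin N) ℂ) :=
    inferInstanceAs (SecondCountableTopology (Fin N → Fin N → ℂ))
  haveI : SecondCountableTopology (Matrix.specialUnitaryGroup (Fin N) ℂ) :=
    Topology.IsEmbedding.subtypeVal.secondCountableTopology
  have hγ : IsSpecification (perturbedYM (d := d) (fundamentalRep (Fin N)) (N * β) W supp) :=
    isSpecification_perturbedYM _ (continuous_fundamentalRep (Fin N)) _ hW hWb hsupp
  have hρ0 : ∀ y : ZdEdge d, 0 ≤ ρ := fun y => (Finset.sum_nonneg fun z _ => hKR.nonneg y z).trans (hrow y)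
  have hμ' : IsGibbsMeasure (perturbedYM (d := d) (fundamentalRep (Fin N)) (N * β) W supp) μ := hμ
  obtain ⟨hm, hM⟩ := measurable_sum_of_isLipschitzCylinder s hF
  -- a common box for the supports
  obtain ⟨m, hm'⟩ : ∃ m : ℕ, ∀ i ∈ s, Δ i ⊆ boxLinks d m := by
    rcases (s.biUnion Δ).eq_empty_or_nonempty with h | hne
    · refine ⟨0, fun i hi e he => ?_⟩
      have : e ∈ s.biUnion Δ := Finset.mem_biUnion.2 ⟨i, hi, he⟩
      rw [h] at this
      exact absurd this (Finset.notMem_empty e)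
    · refine ⟨⌈(s.biUnion Δ).sup' hne (fun e => ‖e.1‖)⌉₊, fun i hi e he => ?_⟩
      rw [mem_boxLinks, mem_siteBox_iff_norm]
      exact (Finset.le_sup' (fun e : ZdEdge d => ‖e.1‖) (Finset.mem_biUnion.2 ⟨i, hi, he⟩)).trans (Nat.le_ceil _)
  exact SpecConcentration.measureReal_abs_sub_integral_ge_le_of_tendsto hγ hm hM
    (c := fun y => ∑ i ∈ s, 2 * Real.sqrt N * K i * ∑ z ∈ Δ i, ρ ^ ⌊‖z.1 - y.1‖ / max 1 R⌋₊)
    (fun y => Finset.sum_nonneg fun i _ => by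
      have hK : (0 : ℝ) ≤ K i := (K i).2
      exact mul_nonneg (by positivity) (Finset.sum_nonneg fun z _ => pow_nonneg (hρ0 y) _))
    (fun Λ' y hy ω η' hωη =>
      abs_kernel_sub_kernel_sum_le_of_isKRContraction hW hWb hsupp hKR hrow hρ hR Λ' hy hωη s hF)
    (fun n => boxLinks d n) hV hμ'
    (fun n ω => abs_box_sum_sub_integral_le_of_isKRContraction hW hWb hsupp hKR hrow hρ hR s hF hm' n hμ ω)
    (tendsto_boundaryRate_box hρ _ m) hr
end Summit.Ventures.YMGap.RobustBall

end
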